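import Summits.Ventures.Crystal3D.Theorems.StickyWulffConstantCoaxialWallLawOnSiteBridgeJoint
import HarnessLib

/-!
# The two census rows of lane F are dominated by the JOINT row; the crux from `P5Exhaustion` and `EndRowJointA v2 (2√6)` alone
# (crux `CoaxialWallLaw`, stmt-Ventures-19481, line `WallLedgerF`)

HONEST FRAMING. Venture `Summits/Ventures/Crystal3D` (cell `crystal3d-full`), helper `--supports` the crux `CoaxialWallLaw`
(stmt-Ventures-19481, `route-Ventures-StickyWulffConstant`), REGISTERED line `WallLedgerF` (planner cf-p1).  Rung credit; F-C1 not
moved; census-free (the certified capstone at the end imports the kissing certificates).  OBSERVATION: the (A) summand is MONOTONE in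
the plate systems' root sets (more admissible classes, more end pairs, same pools), and both systems of the translation row
(`⟨L, inPlaneRoots L 1⟩, ⟨L, inPlaneRoots L (−1)⟩`) and of the twin row (`⟨L, inPlaneRoots L 1⟩, ⟨H·L, inPlaneRoots (H·L) (−1)⟩`) are
sub-systems of the JOINT pair (`⟨L, basalHexagon⟩, ⟨H·L, basalHexagon⟩`, 19481-p1's `EndRowJointA`).  Hence:

* `PlateSystem.adm_mono` — `Adm` is monotone in the root set;
* `isEndPairA_mono_systems`, `endMultA_le_of_systems`, **`localSummandA_le_of_systems`**, `localEndRowA_of_systems` — the (A)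
  summand / local row is monotone under inclusion of the admissible classes;
* **`endRowTransA_of_jointA`**, **`endRowTwinHalfTurnA_of_jointA`** : `EndRowJointA v s → EndRowTransA v s`, `→ EndRowTwinHalfTurnA v s`;
* **`coaxialWallLaw_of_jointA_certified : P5Exhaustion → 0 < s → s ≤ 2√6 → EndRowJointA v s → CoaxialWallLaw`** and the instance
  **`coaxialWallLaw_of_jointA_v2_twoSqrtSix : P5Exhaustion → EndRowJointA v2 (2√6) → CoaxialWallLaw`** — LANE F NEEDS ONLY THE
  JOINT ROW: with `endRowJointA_v2_twoSqrtSix_cx` (`…OnSiteBridgeJoint`) the crux's by-name debts become {P5Exhaustion, bnb-ucx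
  flat(9/2), 'jointrow' flat(2√6), the ONE off-module JOINT tail}; the separate translation/twin tails are no longer needed.
WHAT THIS IS NOT: not the joint row, not its certificate or tail; F-C1 not moved.
-/

noncomputable section

namespace Summit.Ventures.Crystal3D.Theorems

open Summit.Ventures.Crystal3D Finset
open scoped InnerProductSpace

/-! ### Monotonicity in the plate systems -/

/-- `Adm` is monotone in the root set (same base frame). -/
theorem PlateSystem.adm_mono {G₀ : EuclideanSpace ℝ (Fin 3) ≃ₗᵢ[ℝ] EuclideanSpace ℝ (Fin 3)} {R R' : Finset (EuclideanSpace ℝ (Fin 3))}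
    (h : R ⊆ R') {G : EuclideanSpace ℝ (Fin 3) ≃ₗᵢ[ℝ] EuclideanSpace ℝ (Fin 3)} {d : EuclideanSpace ℝ (Fin 3)}
    (hadm : (⟨G₀, R⟩ : PlateSystem).Adm G d) : (⟨G₀, R'⟩ : PlateSystem).Adm G d := by
  obtain ⟨r, hr, κ, hκ, hG, hd⟩ := hadm
  have e : (⟨G₀, R⟩ : PlateSystem).Fw κ = (⟨G₀, R'⟩ : PlateSystem).Fw κ :=
    PlateSystem.fw_eq_of_G₀ (S := ⟨G₀, R⟩) (S' := ⟨G₀, R'⟩) rfl κ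
  exact ⟨r, h hr, κ, hκ, by rw [hG, e], by rw [hd, e]⟩

section Mono

variable {X : Finset (EuclideanSpace ℝ (Fin 3))} {v : WordVersion} {S₁ S₂ S₁' S₂' : PlateSystem}
  (hS : ∀ G d, S₁.Adm G d ∨ S₂.Adm G d → S₁'.Adm G d ∨ S₂'.Adm G d)
include hS

/-- (A)-end pairs are monotone under inclusion of the admissible classes. -/
theorem isEndPairA_mono_systems {b q : EuclideanSpace ℝ (Fin 3)} (h : IsEndPairA X v S₁ S₂ b q) : IsEndPairA X v S₁' S₂' b q := by
  obtain ⟨hq, hb, hpay, G, d, hadm, hpred, hmove⟩ := h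
  exact ⟨hq, hb, hpay, G, d, hS G d hadm, hpred, hmove⟩

open scoped Classical in
/-- Multiplicities are monotone under inclusion of the admissible classes. -/
theorem endMultA_le_of_systems (b : EuclideanSpace ℝ (Fin 3)) : endMultA X v S₁ S₂ b ≤ endMultA X v S₁' S₂' b := by
  unfold endMultA
  exact card_le_card fun q hq => mem_filter.2 ⟨(mem_filter.1 hq).1, isEndPairA_mono_systems hS (mem_filter.1 hq).2⟩

open scoped Classical in
/-- **The (A) summand is monotone under inclusion of the admissible classes** (pools do not depend on the systems). -/
theorem localSummandA_le_of_systems (z : EuclideanSpace ℝ (Fin 3)) :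
    localSummandA v S₁ S₂ X z ≤ localSummandA v S₁' S₂' X z := by
  unfold localSummandA
  have hp : ∀ b, 0 ≤ pooledDef X b := fun b => EndRowFloor.pooledDef_nonneg X b
  calc ∑ b ∈ X.filter (fun b => dist z b ≤ 1 ∧ 0 < endMultA X v S₁ S₂ b), (endMultA X v S₁ S₂ b : ℝ) / pooledDef X b
      ≤ ∑ b ∈ X.filter (fun b => dist z b ≤ 1 ∧ 0 < endMultA X v S₁ S₂ b), (endMultA X v S₁' S₂' b : ℝ) / pooledDef X b :=
        sum_le_sum fun b _ => div_le_div_of_nonneg_right (by exact_mod_cast endMultA_le_of_systems hS b) (hp b)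
    _ ≤ ∑ b ∈ X.filter (fun b => dist z b ≤ 1 ∧ 0 < endMultA X v S₁' S₂' b), (endMultA X v S₁' S₂' b : ℝ) / pooledDef X b := by
        refine sum_le_sum_of_subset_of_nonneg (fun b hb => ?_) fun b _ _ => div_nonneg (Nat.cast_nonneg _) (hp b)
        obtain ⟨hbX, hd, hpos⟩ := mem_filter.1 hb
        exact mem_filter.2 ⟨hbX, hd, lt_of_lt_of_le hpos (endMultA_le_of_systems hS b)⟩

/-- The local (A) row transfers DOWN an inclusion of admissible classes. -/
theorem localEndRowA_of_systems {sF : ℝ} (h : LocalEndRowA v sF S₁' S₂') : LocalEndRowA v sF S₁ S₂ :=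
  fun X hX z hz hdeg => (localSummandA_le_of_systems hS z).trans (h X hX z hz hdeg)

end Mono

/-! ### The translation and twin rows from the joint row -/

/-- The translation systems are sub-systems of the joint pair. -/
theorem adm_trans_sub_joint (L : EuclideanSpace ℝ (Fin 3) ≃ₗᵢ[ℝ] EuclideanSpace ℝ (Fin 3)) :
    ∀ G d, (⟨L, inPlaneRoots L 1⟩ : PlateSystem).Adm G d ∨ (⟨L, inPlaneRoots L (-1)⟩ : PlateSystem).Adm G d →
      (basalSystem L).Adm G d ∨
        (basalSystem (((ℝ ∙ EuclideanSpace.single (2 : Fin 3) (1 : ℝ)).reflection).trans L)).Adm G d := by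
  rintro G d (h | h)
  · exact Or.inl (PlateSystem.adm_mono (inPlaneRoots_subset_basalHexagon L 1) h)
  · exact Or.inl (PlateSystem.adm_mono (inPlaneRoots_subset_basalHexagon L (-1)) h)

/-- The twin systems (half-turn form) are sub-systems of the joint pair. -/
theorem adm_twin_sub_joint (L : EuclideanSpace ℝ (Fin 3) ≃ₗᵢ[ℝ] EuclideanSpace ℝ (Fin 3)) :
    ∀ G d, (⟨L, inPlaneRoots L 1⟩ : PlateSystem).Adm G d ∨
        (⟨((ℝ ∙ EuclideanSpace.single (2 : Fin 3) (1 : ℝ)).reflection).trans L,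
          inPlaneRoots (((ℝ ∙ EuclideanSpace.single (2 : Fin 3) (1 : ℝ)).reflection).trans L) (-1)⟩ : PlateSystem).Adm G d →
      (basalSystem L).Adm G d ∨
        (basalSystem (((ℝ ∙ EuclideanSpace.single (2 : Fin 3) (1 : ℝ)).reflection).trans L)).Adm G d := by
  rintro G d (h | h)
  · exact Or.inl (PlateSystem.adm_mono (inPlaneRoots_subset_basalHexagon L 1) h)
  · exact Or.inr (PlateSystem.adm_mono (inPlaneRoots_subset_basalHexagon _ (-1)) h)

/-- **The translation row from the joint row.** -/
theorem endRowTransA_of_jointA {v : WordVersion} {sF : ℝ} (h : EndRowJointA v sF) : EndRowTransA v sF :=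
  fun L => localEndRowA_of_systems (adm_trans_sub_joint L) (h L)

/-- **The twin row (half-turn form) from the joint row.** -/
theorem endRowTwinHalfTurnA_of_jointA {v : WordVersion} {sF : ℝ} (h : EndRowJointA v sF) : EndRowTwinHalfTurnA v sF :=
  fun L => localEndRowA_of_systems (adm_twin_sub_joint L) (h L)

/-! ### The crux from the joint row -/

/-- **The crux from `P5Exhaustion` and the JOINT row** (any version, `0 < s ≤ 2√6`), kissing facts certified. -/
theorem coaxialWallLaw_of_jointA_certified (ver : WordVersion) (hE1 : P5Exhaustion) {sF : ℝ} (hsF : 0 < sF)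
    (hsF' : sF ≤ 2 * Real.sqrt 6) (hJ : EndRowJointA ver sF) : Summit.Ventures.Crystal3D.Theses.StickyWulffConstant.CoaxialWallLaw :=
  coaxialWallLaw_of_twoRowsA_certified ver hE1 hsF hsF' (endRowTwinHalfTurnA_of_jointA hJ) (endRowTransA_of_jointA hJ)

/-- **LANE F FROM THE JOINT ROW OF RECORD: `P5Exhaustion → EndRowJointA v2 (2√6) → CoaxialWallLaw`.** -/
theorem coaxialWallLaw_of_jointA_v2_twoSqrtSix (hE1 : P5Exhaustion) (hJ : EndRowJointA WordVersion.v2 (2 * Real.sqrt 6)) :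
    Summit.Ventures.Crystal3D.Theses.StickyWulffConstant.CoaxialWallLaw :=
  coaxialWallLaw_of_jointA_certified WordVersion.v2 hE1 two_sqrt_six_pos le_rfl hJ

/-- **The crux from the two 𝒰_cx certificates and the ONE off-module joint tail**: `P5Exhaustion`, bnb-ucx flat at `9/2`,
'jointrow' flat at `2√6`, `EndRowJointTailA v2 (2√6) 𝒰_cx`. -/
theorem coaxialWallLaw_of_jointTail_cx (hE1 : P5Exhaustion) (honT : EndRowOnSiteFlatA WordVersion.v2 (9 / 2) coaxialModuleUniverse)
    (honJ : EndRowOnSiteJointFlatA WordVersion.v2 (2 * Real.sqrt 6) coaxialModuleUniverse)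
    (htail : EndRowJointTailA WordVersion.v2 (2 * Real.sqrt 6) coaxialModuleUniverse) :
    Summit.Ventures.Crystal3D.Theses.StickyWulffConstant.CoaxialWallLaw :=
  coaxialWallLaw_of_jointA_v2_twoSqrtSix hE1 (endRowJointA_v2_twoSqrtSix_cx honT honJ htail)

end Summit.Ventures.Crystal3D.Theorems

end
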